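import Literature.Geometry.Lorentzian.CoordMomentumConstraintVariation
import Literature.Geometry.Lorentzian.CoordScalarCurvatureFirstVariation
import Literature.Geometry.Lorentzian.CoordScalarCurvatureAdjoint
import Literature.Geometry.Lorentzian.CoordConstraintAdjoint
import Literature.Geometry.Lorentzian.CoordCurvatureNormSq
import Literature.Geometry.Lorentzian.ScalarCurvatureLinearization
import HarnessLib

/-!
# The Euclidean background in the coordinate tensor calculus: `Γ = 0`, `R = 0`, `g^{ij} = δ^{ij}`,
# and the constraint map at the flat metric

(trunk G08 = T-LORENTZ; family `gr`; namespace `Literature.Geometry.Lorentzian.MetricCoord`.)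

The coordinate tensor calculus `MetricCoord` (`CoordCurvature.lean` and its sequels: `chrAt`,
`cov₂At`, `ginv`, `mtrAt`, `riemAt`, `ricAt`, `scalAt`, the constraint map `hamAt`/`momFn` and its
linearisation / adjoint) is written for arbitrary components `G`. This file evaluates it at the
**flat background** `G ≡ δ = innerSL ℝ` of a Euclidean space (the background of every
asymptotically flat gluing statement; Mao–Oh–Tao 2023, §2.1: "Linearization around the flat
case"), in an orthonormal basis `b`:

* `isInvertible_innerSL`, `inner_sharpAt_innerSL`, `sharpAt_innerSL_apply` — `δ` is nondegenerate
  and `♯` is the Riesz identification;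
* `chrAt_innerSL`, `chrAt_innerSL_eq`, `cov₂At_innerSL` — `Γ ≡ 0`, so `∇β = Dβ`
  (O'Neill 1983, Ch. 3, Prop. 3.13 with constant `g_{ij}`);
* `ginv_innerSL`, `mtrAt_innerSL` — `g^{ij} = δ^{ij}` and `tr_δ β = Σ_i β(b_i, b_i)`;
* `riemAt_innerSL`, `ricAt_innerSL`, `scalAt_innerSL` — the flat metric is flat;
* `momFn_innerSL` — **the momentum constraint map at `δ` is the linearised momentum-constraint
  operator**: `M_δ(K)(Z) = Σ_k ∂_{b_k} K(b_k, Z) − ∂_Z Σ_i K(b_i, b_i)`, i.e. `Σ_i ∂_i π_{ij}` with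
  `π = K − δ tr_δ K` (Mao–Oh–Tao (2.1), (2.5) at `h = 0`; the same expression as
  `OpensChart.momentumConstraintFn_eq_of_flat` of `ChartMomentumConstraint.lean`);
* `hamAt_innerSL` — `H_δ(K) = −|K|²_δ + (tr_δ K)²` (no curvature term; Mao–Oh–Tao (2.4) at `h = 0`);
* §2 (scalar side): `hessAt_innerSL`, `lapAt_innerSL`, `covDAt_innerSL`, `divAt_innerSL`,
  `divFormVec_innerSL`, `linScalVec_innerSL` and **`linScalAt_innerSL`** — the linearised scalar
  curvature `DS_δ(γ) = div div γ − Δ tr_δ γ = Σ_{jk} ∂_j∂_k γ_{kj} − Σ_j ∂_j² tr_δ γ` of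
  `CoordScalarCurvatureAdjoint.lean` at the flat background (Besse 1.174 (e) with `Ric = 0`), i.e.
  the E-operator `∂_i∂_j h^{ij}` of Mao–Oh–Tao (2.4) (twice `sum_pd_fluxE` of
  `LinearChargeConservation.lean`);
* §3: `linHamFn_zero` (`DH_{(G,0)} = DS_G`), `linMomFn_innerSL_zero`, `linMomFn_innerSL_zero_eq_momFn`
  — the linearised constraint map `DΦ = (DH, DM)` of `CoordConstraintAdjoint.lean` at the flat
  background `(δ, 0)` is `(div div γ − Δ tr_δ γ, div κ − d tr_δ κ)`, i.e. the operator
  `P⃗ = (∂_i∂_j h^{ij}, ∂_i π^{ij})` of Mao–Oh–Tao (2.8) in the variables (2.1).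

Everything is proved; no definitions (the background is the literal constant field
`fun _ ↦ innerSL ℝ`, written `(fun _ : E ↦ (innerSL ℝ : E →L[ℝ] E →L[ℝ] ℝ))` through a local notation), no named facts.

## References

* Y. Mao, S.-J. Oh, T. Tao, arXiv:2308.13031 (2023), §2.1, (2.1)–(2.5) (key `MaoOhTao2023`).
* A. L. Besse, *Einstein manifolds* (1987), 1.59, Thm. 1.174 (key `Besse1987`).
* P. T. Chruściel, E. Delay, Mém. SMF 94 (2003), §2 (key `ChruscielDelay2003`).
* B. O'Neill, *Semi-Riemannian geometry* (1983), Ch. 3, Prop. 3.13, Lemma 3.38, pp. 60–61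
  (key `ONeill1983`).
* R. Bartnik, J. Isenberg, *The constraint equations* (2004), §2, (2.1)–(2.2) (key `BartnikIsenberg2004`).
-/

noncomputable section

-- nested operator spaces `E →L E →L E →L ℝ` (second derivatives of forms), as in the `MetricCoord` files
set_option maxSynthPendingDepth 3

open scoped RealInnerProductSpace

namespace Literature.Geometry.Lorentzian

namespace MetricCoord

variable {E : Type*} [NormedAddCommGroup E] [InnerProductSpace ℝ E] [FiniteDimensional ℝ E]

/-- The flat components are nondegenerate: `v ↦ ⟪v, ·⟫` is the Riesz isomorphism. [folklore] -/
theorem isInvertible_innerSL (x : E) :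
    ((fun _ : E ↦ (innerSL ℝ : E →L[ℝ] E →L[ℝ] ℝ)) x).IsInvertible := by
  refine ⟨((InnerProductSpace.toDual ℝ E).toContinuousLinearEquiv : E ≃L[ℝ] (E →L[ℝ] ℝ)), ?_⟩
  ext v w
  rfl

/-- Index raising for `δ`: `⟪♯φ, w⟫ = φ(w)`. [cite: ONeill1983, Ch. 3, p. 60] -/
theorem inner_sharpAt_innerSL (x : E) (φ : E →L[ℝ] ℝ) (w : E) :
    ⟪sharpAt (fun _ : E ↦ (innerSL ℝ : E →L[ℝ] E →L[ℝ] ℝ)) x φ, w⟫ = φ w :=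
  apply_sharpAt_apply (G := (fun _ : E ↦ (innerSL ℝ : E →L[ℝ] E →L[ℝ] ℝ))) (x := x) (isInvertible_innerSL x) φ w

omit [FiniteDimensional ℝ E] in
/-- **The Christoffel map of the flat components vanishes**, `Γ_x ≡ 0` (all `∂g_{ij} = 0` in the Koszul form).
[cite: ONeill1983, Ch. 3, Prop. 3.13] -/
theorem chrAt_innerSL (x : E) : chrAt (fun _ : E ↦ (innerSL ℝ : E →L[ℝ] E →L[ℝ] ℝ)) x = 0 := by
  ext X Y
  rw [chrAt_apply]
  have h0 : koszulCLM (fun _ : E ↦ (innerSL ℝ : E →L[ℝ] E →L[ℝ] ℝ)) x = 0 := by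
    ext A B C
    simp [koszulCLM_apply]
  simp [h0]

omit [FiniteDimensional ℝ E] in
/-- For the flat components the covariant derivative of a field of bilinear forms is its plain derivative:
`(∇β)_x(W; Y, Z) = Dβ(x)(W)(Y, Z)`. [cite: ONeill1983, Ch. 2, Prop. 2.13] -/
theorem cov₂At_innerSL (β : E → E →L[ℝ] E →L[ℝ] ℝ) (x W Y Z : E) :
    cov₂At (fun _ : E ↦ (innerSL ℝ : E →L[ℝ] E →L[ℝ] ℝ)) β x W Y Z = fderiv ℝ β x W Y Z := by
  simp [cov₂At_apply, chrAt_innerSL]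

/-- `♯⟪v, ·⟫ = v` for the flat components. [cite: ONeill1983, Ch. 3, p. 60] -/
theorem sharpAt_innerSL_apply (x v : E) :
    sharpAt (fun _ : E ↦ (innerSL ℝ : E →L[ℝ] E →L[ℝ] ℝ)) x ((innerSL ℝ : E →L[ℝ] E →L[ℝ] ℝ) v) = v :=
  sharpAt_apply (G := (fun _ : E ↦ (innerSL ℝ : E →L[ℝ] E →L[ℝ] ℝ))) (x := x) (isInvertible_innerSL x) v

variable {ι : Type*} [Fintype ι] [DecidableEq ι]

/-- **`g^{ij} = δ^{ij}`**: the inverse metric coefficients of the flat components in an orthonormal basis (coordinates in an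
orthonormal basis are inner products). [cite: ONeill1983, Ch. 3, p. 60] -/
theorem ginv_innerSL (b : Module.Basis ι ℝ E) (hb : Orthonormal ℝ b) (x : E) (i j : ι) :
    ginv (fun _ : E ↦ (innerSL ℝ : E →L[ℝ] E →L[ℝ] ℝ)) b x i j = if i = j then 1 else 0 := by
  have hcoord : (coordCLM b j : E →L[ℝ] ℝ) = (innerSL ℝ : E →L[ℝ] E →L[ℝ] ℝ) (b j) := by
    ext w
    rw [coordCLM_apply]
    show b.coord j w = ⟪b j, w⟫
    rw [Module.Basis.coord_apply]
    conv_rhs => rw [← b.sum_repr w]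
    rw [inner_sum, Finset.sum_eq_single j]
    · rw [real_inner_smul_right, (orthonormal_iff_ite.1 hb) j j, if_pos rfl, mul_one]
    · intro k _ hk
      rw [real_inner_smul_right, (orthonormal_iff_ite.1 hb) j k, if_neg (Ne.symm hk), mul_zero]
    · intro h
      exact absurd (Finset.mem_univ j) h
  rw [ginv, hcoord, sharpAt_innerSL_apply, Module.Basis.coord_apply, Module.Basis.repr_self,
    Finsupp.single_apply]
  exact if_congr ⟨Eq.symm, Eq.symm⟩ rfl rfl

/-- `tr_δ β = Σ_i β(b_i, b_i)` in an orthonormal basis. [cite: ONeill1983, Ch. 3, pp. 60–61] -/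
theorem mtrAt_innerSL (b : Module.Basis ι ℝ E) (hb : Orthonormal ℝ b) (x : E) (β : E →L[ℝ] E →L[ℝ] ℝ) :
    mtrAt (fun _ : E ↦ (innerSL ℝ : E →L[ℝ] E →L[ℝ] ℝ)) x β = ∑ i, β (b i) (b i) := by
  rw [mtrAt_eq_sum (b := b)]
  simp only [ginv_innerSL b hb, ite_mul, one_mul, zero_mul, Finset.sum_ite_eq, Finset.mem_univ, if_true]

/-- **The momentum constraint map at the flat metric is the linearised momentum-constraint operator**: in an orthonormal
basis, `M_δ(K)(Z) = Σ_k ∂_{b_k} K(b_k, Z) − ∂_Z Σ_i K(b_i, b_i)` (`= Σ_i ∂_i π_{ij}` for `Z = b_j`, `π = K − δ tr_δ K`;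
Mao–Oh–Tao (2.1) and (2.5) at `h = 0`, all `N`-terms vanishing). [cite: MaoOhTao2023, §2.1, (2.5)] -/
theorem momFn_innerSL (b : Module.Basis ι ℝ E) (hb : Orthonormal ℝ b) (K : E → E →L[ℝ] E →L[ℝ] ℝ)
    (x Z : E) :
    momFn b (fun _ : E ↦ (innerSL ℝ : E →L[ℝ] E →L[ℝ] ℝ)) K x Z =
      (∑ k, fderiv ℝ K x (b k) (b k) Z) - fderiv ℝ (fun y ↦ ∑ i, K y (b i) (b i)) x Z := by
  rw [momFn_eq]
  simp only [ginv_innerSL b hb, cov₂At_innerSL, ite_mul, one_mul, zero_mul, Finset.sum_ite_eq,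
    Finset.mem_univ, if_true, mtrAt_innerSL b hb]

omit [FiniteDimensional ℝ E] in
/-- The Christoffel field of the flat components is the zero field. [cite: ONeill1983, Ch. 3, Prop. 3.13] -/
theorem chrAt_innerSL_eq : chrAt (fun _ : E ↦ (innerSL ℝ : E →L[ℝ] E →L[ℝ] ℝ)) = fun _ ↦ 0 := funext chrAt_innerSL

omit [FiniteDimensional ℝ E] in
/-- **The flat components are flat**: `R ≡ 0`. [cite: ONeill1983, Ch. 3, Lemma 3.38] -/
theorem riemAt_innerSL (x X Y : E) : riemAt (fun _ : E ↦ (innerSL ℝ : E →L[ℝ] E →L[ℝ] ℝ)) x X Y = 0 := by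
  ext Z
  rw [riemAt_apply, chrAt_innerSL_eq]
  simp

/-- `Ric_δ ≡ 0`. [cite: ONeill1983, Ch. 3, Def. 3.51] -/
theorem ricAt_innerSL (x : E) : ricAt (fun _ : E ↦ (innerSL ℝ : E →L[ℝ] E →L[ℝ] ℝ)) x = 0 := by
  ext Y Z
  rw [ricAt_apply]
  have h : ricciEndo (fun _ : E ↦ (innerSL ℝ : E →L[ℝ] E →L[ℝ] ℝ)) x Y Z = 0 := LinearMap.ext fun X ↦ by
    rw [ricciEndo_apply, riemAt_innerSL]; rfl
  rw [h, map_zero]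
  rfl

/-- `S_δ ≡ 0`. [cite: ONeill1983, Ch. 3, Def. 3.53] -/
theorem scalAt_innerSL (x : E) : scalAt (fun _ : E ↦ (innerSL ℝ : E →L[ℝ] E →L[ℝ] ℝ)) x = 0 := by
  rw [scalAt, ricAt_innerSL]
  simp [mtrAt]

/-- **The Hamiltonian constraint density at the flat metric**: `H_δ(K) = −|K|²_δ + (tr_δ K)²` in an orthonormal basis
(Mao–Oh–Tao (2.4) at `h = 0`: no curvature term, `(tr k)² − |k|² = −M⁽⁰⁾(π, π)`). [cite: MaoOhTao2023, §2.1, (2.4)] -/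
theorem hamAt_innerSL (b : Module.Basis ι ℝ E) (hb : Orthonormal ℝ b) (K : E → E →L[ℝ] E →L[ℝ] ℝ) (x : E) :
    hamAt (fun _ : E ↦ (innerSL ℝ : E →L[ℝ] E →L[ℝ] ℝ)) K x =
      -normSqAt (fun _ : E ↦ (innerSL ℝ : E →L[ℝ] E →L[ℝ] ℝ)) x (K x) + (∑ i, K x (b i) (b i)) ^ 2 := by
  rw [hamAt_eq, scalAt_innerSL, mtrAt_innerSL b hb, zero_sub]

/-! ## §2 The scalar side: Hessian, Laplacian, divergence and the linearised scalar curvature at `δ` -/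

section Scalar

variable (b : Module.Basis ι ℝ E)

omit [FiniteDimensional ℝ E] [Fintype ι] in
/-- An orthonormal basis is `δ`-orthonormal in the sense of `CoordCurvatureNormSq` (`G_x(b_i, b_j) = δ_{ij}`). [folklore] -/
theorem innerSL_basis_ite (hb : Orthonormal ℝ b) (x : E) (i j : ι) :
    ((fun _ : E ↦ (innerSL ℝ : E →L[ℝ] E →L[ℝ] ℝ))) x (b i) (b j) = if i = j then 1 else 0 :=
  (orthonormal_iff_ite.1 hb) i j

omit [FiniteDimensional ℝ E] in
/-- The coordinate Hessian for the flat components is the second derivative. [cite: ONeill1983, Ch. 3, Lemma 3.49] -/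
theorem hessAt_innerSL (f : E → ℝ) (x Y Z : E) :
    hessAt (fun _ : E ↦ (innerSL ℝ : E →L[ℝ] E →L[ℝ] ℝ)) f x Y Z = fderiv ℝ (fderiv ℝ f) x Y Z := by
  simp [hessAt_apply, chrAt_innerSL]

/-- **`Δ_δ f = Σ_k ∂_k∂_k f`** in an orthonormal basis. [cite: ONeill1983, Ch. 3, Def. 3.50] -/
theorem lapAt_innerSL (hb : Orthonormal ℝ b) (f : E → ℝ) (x : E) :
    lapAt (fun _ : E ↦ (innerSL ℝ : E →L[ℝ] E →L[ℝ] ℝ)) f x = ∑ k, fderiv ℝ (fderiv ℝ f) x (b k) (b k) := by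
  rw [lapAt_eq_sum (b := b)]
  simp only [ginv_innerSL b hb, chrAt_innerSL, zero_apply, map_zero, sub_zero,
    ite_mul, one_mul, zero_mul, Finset.sum_ite_eq, Finset.mem_univ, if_true]

omit [FiniteDimensional ℝ E] in
/-- For the flat components the covariant differential of a vector field is its derivative. [cite: ONeill1983, Ch. 3, Prop. 3.13] -/
theorem covDAt_innerSL (Z : E → E) (x : E) :
    covDAt (fun _ : E ↦ (innerSL ℝ : E →L[ℝ] E →L[ℝ] ℝ)) Z x = fderiv ℝ Z x := by
  ext X
  simp [covDAt_apply, chrAt_innerSL]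

/-- **`div_δ Z = Σ_i ⟪DZ(x) b_i, b_i⟫ = tr DZ(x)`** in an orthonormal basis. [cite: ONeill1983, Ch. 3, p. 86] -/
theorem divAt_innerSL (hb : Orthonormal ℝ b) (Z : E → E) (x : E) :
    divAt (fun _ : E ↦ (innerSL ℝ : E →L[ℝ] E →L[ℝ] ℝ)) Z x = ∑ i, ⟪fderiv ℝ Z x (b i), b i⟫ := by
  rw [divAt_eq, covDAt_innerSL,
    traceCLM_eq_sum_of_orthonormal (G := (fun _ : E ↦ (innerSL ℝ : E →L[ℝ] E →L[ℝ] ℝ))) (x := x) b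
      (innerSL_basis_ite b hb x)]
  rfl

omit [FiniteDimensional ℝ E] in
/-- Index raising for the (constant) flat components does not depend on the point. [folklore] -/
theorem sharpAt_innerSL_eq (x : E) :
    sharpAt (fun _ : E ↦ (innerSL ℝ : E →L[ℝ] E →L[ℝ] ℝ)) x =
      sharpAt (fun _ : E ↦ (innerSL ℝ : E →L[ℝ] E →L[ℝ] ℝ)) 0 := rfl

/-- The metric pairing with the zero form vanishes. [folklore] -/
theorem pairAt_zero_right (x : E) (α : E →L[ℝ] E →L[ℝ] ℝ) :
    pairAt (fun _ : E ↦ (innerSL ℝ : E →L[ℝ] E →L[ℝ] ℝ)) x α 0 = 0 := by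
  simp [pairAt_apply]

/-- The raised divergence of a field of bilinear forms at `δ`: `(div_δ γ)^♯ = ♯(Σ_k ∂_{b_k} γ(b_k, ·))`.
[cite: Besse1987, 1.59] -/
theorem divFormVec_innerSL (hb : Orthonormal ℝ b) (γ : E → E →L[ℝ] E →L[ℝ] ℝ) (x : E) :
    divFormVec b (fun _ : E ↦ (innerSL ℝ : E →L[ℝ] E →L[ℝ] ℝ)) γ x =
      sharpAt (fun _ : E ↦ (innerSL ℝ : E →L[ℝ] E →L[ℝ] ℝ)) 0 (∑ k, fderiv ℝ γ x (b k) (b k)) := by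
  rw [divFormVec, map_sum]
  simp only [ginv_innerSL b hb, ite_smul, one_smul, zero_smul, Finset.sum_ite_eq, Finset.mem_univ,
    if_true]
  refine Finset.sum_congr rfl fun k _ ↦ ?_
  congr 1
  ext Z
  rw [cov₂At_innerSL]

/-- The vector field `W_γ = (div γ)^♯ − ½ ∇ tr γ` of the first variation of the scalar curvature, at `δ`.
[cite: Besse1987, Thm. 1.174 (a)] -/
theorem linScalVec_innerSL (hb : Orthonormal ℝ b) (γ : E → E →L[ℝ] E →L[ℝ] ℝ) (x : E) :
    linScalVec b (fun _ : E ↦ (innerSL ℝ : E →L[ℝ] E →L[ℝ] ℝ)) γ x =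
      sharpAt (fun _ : E ↦ (innerSL ℝ : E →L[ℝ] E →L[ℝ] ℝ)) 0 ((∑ k, fderiv ℝ γ x (b k) (b k))
      - (2⁻¹ : ℝ) • fderiv ℝ (fun y ↦ ∑ i, γ y (b i) (b i)) x) := by
  rw [linScalVec, divFormVec_innerSL b hb, map_sub, map_smul]
  simp only [mtrAt_innerSL b hb]
  rfl


omit [FiniteDimensional ℝ E] in
/-- Evaluation commutes with differentiation (two slots, then the resulting covector): for a differentiable family of
trilinear forms, `(∂_z (H(·) u v))(x) w = DH(x)(z)(u)(v)(w)` (`fderiv_apply₃`). [folklore] -/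
theorem fderiv_apply₂_apply {H : E → E →L[ℝ] E →L[ℝ] E →L[ℝ] ℝ} {x : E} (hH : DifferentiableAt ℝ H x)
    (u v w z : E) : fderiv ℝ (fun y ↦ H y u v) x z w = fderiv ℝ H x z u v w := by
  have h1 : DifferentiableAt ℝ (fun y ↦ H y u) x := hH.clm_apply (differentiableAt_const u)
  have h2 : DifferentiableAt ℝ (fun y ↦ H y u v) x := h1.clm_apply (differentiableAt_const v)
  rw [← fderiv_apply₃ hH u v w z, fderiv_clm_apply h2 (differentiableAt_const w)]
  simp [fderiv_fun_const]

/-- **The linearised scalar curvature at the flat metric**: for `γ` of class `C²` at `x` and an orthonormal basis,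
`DS_δ(γ)(x) = Σ_{jk} ∂_j∂_k γ(b_k, b_j) − Σ_j ∂_j∂_j (Σ_i γ(b_i, b_i)) = div div γ − Δ tr_δ γ`
(Besse 1.174 (e) at the flat metric: the Ricci term drops; Mao–Oh–Tao (2.4): `R[g] = ∂_i∂_j h^{ij} − …` with
`h = γ − δ tr_δ γ`, whose double divergence is `div div γ − Δ tr γ`; twice the divergence `sum_pd_fluxE` of the energy flux of
`LinearChargeConservation.lean`). [cite: MaoOhTao2023, §2.1, (2.4)] -/
theorem linScalAt_innerSL (hb : Orthonormal ℝ b) (γ : E → E →L[ℝ] E →L[ℝ] ℝ) (x : E)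
    (hγ : ContDiffAt ℝ 2 γ x) :
    linScalAt b (fun _ : E ↦ (innerSL ℝ : E →L[ℝ] E →L[ℝ] ℝ)) γ x =
      (∑ j, ∑ k, fderiv ℝ (fderiv ℝ γ) x (b j) (b k) (b k) (b j))
        - ∑ j, fderiv ℝ (fderiv ℝ (fun y ↦ ∑ i, γ y (b i) (b i))) x (b j) (b j) := by
  have hT2 : ContDiffAt ℝ 2 (fun y ↦ ∑ i, γ y (b i) (b i)) x :=
    ContDiffAt.sum fun i _ ↦ (hγ.clm_apply contDiffAt_const).clm_apply contDiffAt_const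
  have hTd : DifferentiableAt ℝ (fderiv ℝ (fun y ↦ ∑ i, γ y (b i) (b i))) x :=
    (hT2.fderiv_right (m := 1) le_rfl).differentiableAt one_ne_zero
  have hγd : DifferentiableAt ℝ (fderiv ℝ γ) x :=
    (hγ.fderiv_right (m := 1) le_rfl).differentiableAt one_ne_zero
  have htr : (fun y ↦ mtrAt (fun _ : E ↦ (innerSL ℝ : E →L[ℝ] E →L[ℝ] ℝ)) y (γ y)) = fun y ↦ ∑ i, γ y (b i) (b i) :=
    funext fun y ↦ mtrAt_innerSL b hb y (γ y)
  have hΦk : ∀ k, DifferentiableAt ℝ (fun y ↦ fderiv ℝ γ y (b k) (b k)) x := fun k ↦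
    (hγd.clm_apply (differentiableAt_const _)).clm_apply (differentiableAt_const _)
  have hF : DifferentiableAt ℝ (fun y ↦ ∑ k, fderiv ℝ γ y (b k) (b k)) x :=
    DifferentiableAt.fun_sum fun k _ ↦ hΦk k
  -- the vector field `W_γ = ♯Φ`, `Φ = Σ_k ∂_{b_k}γ(b_k, ·) − ½ d tr γ` (Pi form)
  have hΦd : DifferentiableAt ℝ
      ((fun y ↦ ∑ k, fderiv ℝ γ y (b k) (b k)) - (2⁻¹ : ℝ) • fderiv ℝ (fun y ↦ ∑ i, γ y (b i) (b i))) x :=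
    hF.sub (hTd.const_smul _)
  have hW : linScalVec b (fun _ : E ↦ (innerSL ℝ : E →L[ℝ] E →L[ℝ] ℝ)) γ =
      fun y ↦ sharpAt (fun _ : E ↦ (innerSL ℝ : E →L[ℝ] E →L[ℝ] ℝ)) 0
      (((fun y ↦ ∑ k, fderiv ℝ γ y (b k) (b k)) - (2⁻¹ : ℝ) • fderiv ℝ (fun y ↦ ∑ i, γ y (b i) (b i))) y) :=
    funext fun y ↦ by
      rw [linScalVec_innerSL b hb γ y, Pi.sub_apply, Pi.smul_apply]
  have hfd : fderiv ℝ (fun y ↦ sharpAt (fun _ : E ↦ (innerSL ℝ : E →L[ℝ] E →L[ℝ] ℝ)) 0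
      (((fun y ↦ ∑ k, fderiv ℝ γ y (b k) (b k)) - (2⁻¹ : ℝ) • fderiv ℝ (fun y ↦ ∑ i, γ y (b i) (b i))) y)) x =
      (sharpAt (fun _ : E ↦ (innerSL ℝ : E →L[ℝ] E →L[ℝ] ℝ)) 0).comp (fderiv ℝ ((fun y ↦ ∑ k, fderiv ℝ γ y (b k) (b k))
        - (2⁻¹ : ℝ) • fderiv ℝ (fun y ↦ ∑ i, γ y (b i) (b i))) x) :=
    ((sharpAt (fun _ : E ↦ (innerSL ℝ : E →L[ℝ] E →L[ℝ] ℝ)) 0).hasFDerivAt.comp x hΦd.hasFDerivAt).fderiv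
  have hΦ' : ∀ i, fderiv ℝ ((fun y ↦ ∑ k, fderiv ℝ γ y (b k) (b k))
      - (2⁻¹ : ℝ) • fderiv ℝ (fun y ↦ ∑ i, γ y (b i) (b i))) x (b i) (b i) =
      (∑ k, fderiv ℝ (fderiv ℝ γ) x (b i) (b k) (b k) (b i))
        - 2⁻¹ * fderiv ℝ (fderiv ℝ (fun y ↦ ∑ i, γ y (b i) (b i))) x (b i) (b i) := by
    intro i
    rw [fderiv_sub hF (hTd.const_smul _), fderiv_const_smul hTd, fderiv_fun_sum fun k _ ↦ hΦk k]
    simp only [_root_.sub_apply, FunLike.coe_sum, Finset.sum_apply, FunLike.coe_smul, Pi.smul_apply,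
      smul_eq_mul, fderiv_apply₂_apply hγd]
  rw [linScalAt, ricAt_innerSL, pairAt_zero_right, neg_zero, zero_add, htr, lapAt_innerSL b hb,
    hW, divAt_innerSL b hb, hfd]
  simp only [ContinuousLinearMap.comp_apply, inner_sharpAt_innerSL, hΦ', Finset.sum_sub_distrib,
    ← Finset.mul_sum]
  ring

end Scalar

/-! ## §3 The linearised constraint map `DΦ` at the flat background `(δ, 0)` -/

section LinConstraint

variable (b : Module.Basis ι ℝ E)

omit [DecidableEq ι] in
/-- **At `K = 0` the linearised Hamiltonian constraint is the linearised scalar curvature**, `DH_{(G,0)}(γ, κ) = DS_G(γ)`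
(all `K`-terms of `linHamFn` vanish; any components `G`). [cite: ChruscielDelay2003, §2] -/
theorem linHamFn_zero (G γ κ : E → E →L[ℝ] E →L[ℝ] ℝ) (x : E) :
    linHamFn b G (fun _ ↦ 0) γ κ x = linScalAt b G γ x := by
  rw [linHamFn]
  simp [pairAt_apply, mtrAt]

/-- **At the flat background `(δ, 0)` the linearised momentum constraint is** `DM_{(δ,0)}(γ, κ)(Z) =
Σ_k ∂_{b_k} κ(b_k, Z) − ∂_Z Σ_i κ(b_i, b_i)` (`= Σ_i ∂_i π_{ij}`, `π = κ − δ tr_δ κ`, for `Z = b_j`): the `γ`-row drops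
(`∇0 = 0`, `⟨γ, 0⟩ = 0`) and `Γ_δ = 0`, `g^{ij} = δ^{ij}`. Mao–Oh–Tao (2.5) linearised at `h = 0`.
[cite: MaoOhTao2023, §2.1, (2.5)] -/
theorem linMomFn_innerSL_zero (hb : Orthonormal ℝ b) (γ κ : E → E →L[ℝ] E →L[ℝ] ℝ) (x Z : E) :
    linMomFn b (fun _ : E ↦ (innerSL ℝ : E →L[ℝ] E →L[ℝ] ℝ)) (fun _ ↦ 0) γ κ x Z =
      (∑ k, fderiv ℝ κ x (b k) (b k) Z) - fderiv ℝ (fun y ↦ ∑ i, κ y (b i) (b i)) x Z := by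
  rw [linMomFn_eq]
  have h0 : cov₂At (fun _ : E ↦ (innerSL ℝ : E →L[ℝ] E →L[ℝ] ℝ))
      (fun _ : E ↦ (0 : E →L[ℝ] E →L[ℝ] ℝ)) x = 0 := by
    ext W Y Z'
    simp [cov₂At_apply]
  simp only [h0, zero_apply, mul_zero, zero_add, sub_zero, pairAt_zero_right, ginv_innerSL b hb,
    cov₂At_innerSL, mtrAt_innerSL b hb, ite_mul, one_mul, zero_mul, Finset.sum_ite_eq,
    Finset.mem_univ, if_true]

/-- Hence `DM_{(δ,0)}(γ, κ) = M_δ(κ)` (`momFn_innerSL`): together with `linHamFn_zero` and `linScalAt_innerSL`, the linearised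
constraint map of the `MetricCoord` calculus at the flat background is
`DΦ_{(δ,0)}(γ, κ) = (div div γ − Δ tr_δ γ, div κ − d tr_δ κ)`, the operator `P⃗ = (∂_i∂_j h^{ij}, ∂_i π^{ij})` of
Mao–Oh–Tao (2.8) in the variables (2.1). [cite: MaoOhTao2023, §2.1, (2.8)] -/
theorem linMomFn_innerSL_zero_eq_momFn (hb : Orthonormal ℝ b) (γ κ : E → E →L[ℝ] E →L[ℝ] ℝ)
    (x Z : E) :
    linMomFn b (fun _ : E ↦ (innerSL ℝ : E →L[ℝ] E →L[ℝ] ℝ)) (fun _ ↦ 0) γ κ x Z =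
      momFn b (fun _ : E ↦ (innerSL ℝ : E →L[ℝ] E →L[ℝ] ℝ)) κ x Z := by
  rw [linMomFn_innerSL_zero b hb, momFn_innerSL b hb]

end LinConstraint

end MetricCoord

end Literature.Geometry.Lorentzian

end
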